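import Summits.AnomalousDissipation.AnomalousDissipation.Theorems.SolenoidalFractalHomogenisationLagrangianStepVmodLossAdjDuality
import Summits.AnomalousDissipation.AnomalousDissipation.Theorems.SolenoidalFractalHomogenisationLagrangianStepVmodFrameDefs
import Literature.Analysis.FluidPDE.PassiveVectorWeakGradientGarding
import Literature.Analysis.FluidPDE.PassiveVectorWeakGradientPiola
import HarnessLib

/-!
# K1L_D (stmt-AnomalousDissipation-27980), (ℓ3-A) road A, (S2) glue: COERCIVITY of the dissipation density of a binder witness —
# `c(lo,h,η,θ)·∫Σ_c‖Dw τ c‖² ≤ D(τ)` for a.e. `τ` (weak-gradient twisted Gårding T2 + weak Piola identity, on the witness)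
(helper; `--supports 27980 --as helper`; prover ad-k1loc-p3 g12; composes `Literature/…/PassiveVectorWeakGradientGarding` (p735159) and
`…/PassiveVectorWeakGradientPiola` (p735708) with the slice facts of a distorted weak solution carrying an `L²` weak gradient — exactly what
`EnergyIdG` / `EnergyIdGAdj` / `EnergyDuhamelG` hand out.)

CONVENTION (D28-8′): derivative-index distortion `Torus.Visc4.conj`; constraint `∇·(G v) = 0`.

* **`ae_dissipation_ge_of_witness`** — for a distorted weak solution `ψ` (tensor `𝔸'`, frames `G' σ` with smooth entries, divergence-free columns and
  `|G' σ − 1| ≤ θ`) with an `L²` weak gradient `Dψ` on the slab `(0,L)`, and `NearIso 𝔸' lo hi`, `FullBound 𝔸' h` (device hypothesis), `0 < η ≤ lo`: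
  for a.e. `σ ∈ (0,L)`,
  `(lo − η − (lo−η+h+h²/η)(3θ)² − h(6θ+9θ²)) · ∫ Σ_c ‖Dψ σ c x‖² ≤ ∫ Σ_{l,i,c,e} (𝔸')^{G' σ x}_{icle} (Dψ σ c x)_i (Dψ σ e x)_l`
  (the right side is the `EnergyIdG(Adj)` integrand).  For the ADJOINT member read `𝔸' := 𝔸Tᵀ` (`nearIso_majorTranspose_iff`,
  `fullBound_majorTranspose`), `G' σ := G (t₀ − σ)`; for the forward member `𝔸' := 𝔹₀`, `G' τ := G (s + τ)` — the frame facts come from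
  `IsFrameModulation.smooth_all` / `piola_all` / `near_one`.
* `IsFrameModulation.frameFacts_shift` — those three facts for `τ ↦ G (s + τ)` and `σ ↦ G (t₀ − σ)` packaged.
This is the (b)+(c)-type input of D28-26 (2) option 1 («dissipation ≥ κ·gradient energy») and the `∫‖Dψ‖² ≤ lossAdj/(2c)` step of the bandwidth
route (S2-NOTE-p3g12 §3 (T2)).  `sorry`-free; NOT a proof of any block, of K1L_D or of AD; rung F-D1.A0.
-/

set_option linter.dupNamespace false

noncomputable section

namespace Summit.AnomalousDissipation.AnomalousDissipation.Theorems.SolenoidalFractalHomogenisation.LagrangianStep.VmodDist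

open Literature.Analysis Literature.Analysis.FluidPDE Literature.Analysis.FunctionSpaces
open MeasureTheory Set Filter Function
open scoped ENNReal NNReal InnerProductSpace
open Summit.AnomalousDissipation.AnomalousDissipation.Theorems.SolenoidalFractalHomogenisation.LagrangianStep.CellClauseMod

/-- **Coercivity of the dissipation density on a witness.**  See the module docstring. -/
theorem ae_dissipation_ge_of_witness {A L : ℝ} {𝔸' : Torus.Visc4 (Fin 3)} {b' : ℝ → VF} {G' : ℝ → UnitAddTorus (Fin 3) → Matrix (Fin 3) (Fin 3) ℝ}
    {ψ₀ : VF} {ψ : ℝ → VF} {Dψ : ℝ → Fin 3 → VF}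
    (hcl : Torus.IsWeakTensorPassiveVectorDistortedOn A L 𝔸' b' G' ψ₀ ψ)
    (hM : ∀ c, MemLp (uncurry (Dψ · c)) 2 (((volume : Measure ℝ).restrict (Ioo 0 L)).prod volume))
    (hD : ∀ᵐ σ ∂(volume.restrict (Ioo 0 L)), ∀ c, Torus.HasWeakPartialDeriv c (ψ σ) (Dψ σ c))
    (hGs : ∀ σ c a, Torus.IsSmooth (fun y => G' σ y c a))
    (hGp : ∀ σ a, Torus.IsDivFree (fun y => (WithLp.toLp 2 fun c => G' σ y c a : EuclideanSpace ℝ (Fin 3))))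
    {θ : ℝ} (hθ : 0 ≤ θ) (hG1 : ∀ σ y c a, |G' σ y c a - (1 : Matrix (Fin 3) (Fin 3) ℝ) c a| ≤ θ)
    {lo hi h η : ℝ} (hN : Torus.NearIso 𝔸' lo hi) (hB : Torus.FullBound 𝔸' h) (hh : 0 ≤ h) (hη : 0 < η) (hηlo : η ≤ lo) :
    ∀ᵐ σ ∂(volume.restrict (Ioo 0 L)),
      (lo - η - (lo - η + h + h ^ 2 / η) * (3 * θ) ^ 2 - h * (2 * (3 * θ) + (3 * θ) ^ 2)) * ∫ x, ∑ c, ‖Dψ σ c x‖ ^ 2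
        ≤ ∫ x, ∑ l, ∑ i, ∑ c, ∑ e, Torus.Visc4.conj (G' σ x) 𝔸' i c l e * (Dψ σ c x) i * (Dψ σ e x) l := by
  have hψ2 := hcl.ae_memLp_two
  have hD2 : ∀ᵐ σ ∂(volume.restrict (Ioo 0 L)), ∀ c, MemLp (Dψ σ c) 2 volume := ae_all_iff.2 fun c => ae_memLp_two_slice (hM c)
  filter_upwards [hψ2, hD2, hD, hcl.ae_isWeaklyDivFree_distort] with σ h1 h2 h3 h4
  have hPiola := Torus.ae_sum_frame_mul_weakGradient_eq_zero (hGs σ) (hGp σ) (D := Dψ σ) h1 h2 h3 h4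
  have key := Torus.integral_gradForm_conj_weakGradient_ge hN hB hh hη hηlo (G := G' σ) (fun c a => (hGs σ c a).continuous) hθ (hG1 σ)
    h1 h2 h3 hPiola
  have hcard : (Fintype.card (Fin 3) : ℝ) = 3 := by simp
  rw [hcard] at key
  have e : ∫ x, ∑ l, ∑ i, ∑ c, ∑ e, Torus.Visc4.conj (G' σ x) 𝔸' i c l e * (Dψ σ c x) i * (Dψ σ e x) l
      = ∫ x, ∑ i, ∑ a, ∑ j, ∑ b, Torus.Visc4.conj (G' σ x) 𝔸' i a j b * (Dψ σ a x) i * (Dψ σ b x) j := by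
    refine integral_congr_ae (Eventually.of_forall fun x => ?_)
    beta_reduce
    rw [quadForm_eq_gradForm, Torus.gradForm_eq_sum_mul_mul]
  rw [e]
  exact key

variable {θ Tw nC : ℝ} {G : ℝ → UnitAddTorus (Fin 3) → Matrix (Fin 3) (Fin 3) ℝ}

/-- The three frame facts for the SHIFTED and the REVERSED frame families of the binders, from `IsFrameModulation` (clamped datum: all real times). -/
theorem IsFrameModulation.frameFacts_shift (hG : IsFrameModulation θ Tw nC G) (hTw : 0 ≤ Tw) (φ : ℝ → ℝ) :
    (∀ σ c a, Torus.IsSmooth (fun y => G (φ σ) y c a)) ∧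
    (∀ σ a, Torus.IsDivFree (fun y => (WithLp.toLp 2 fun c => G (φ σ) y c a : EuclideanSpace ℝ (Fin 3)))) ∧
    (∀ σ y c a, |G (φ σ) y c a - (1 : Matrix (Fin 3) (Fin 3) ℝ) c a| ≤ θ) := by
  refine ⟨fun σ c a => hG.smooth_all hTw _ c a, fun σ a => hG.piola_all hTw _ a, fun σ y c a => ?_⟩
  have hmem : max 0 (min (φ σ) Tw) ∈ Icc 0 Tw := ⟨le_max_left _ _, max_le hTw (min_le_right _ _)⟩
  rw [hG.clamped (φ σ) y]
  exact hG.near_one _ hmem y c a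

end Summit.AnomalousDissipation.AnomalousDissipation.Theorems.SolenoidalFractalHomogenisation.LagrangianStep.VmodDist

end
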